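import Mathlib
import HarnessLib
import Summits.RiemannHypothesis.RiemannHypothesis.Theses.RuelleBand
import Summits.RiemannHypothesis.RiemannHypothesis.Theorems.RuelleBandAsymptoticCriticalLineHennionDecomposition
import Summits.RiemannHypothesis.RiemannHypothesis.Theorems.RuelleBandBandRealisationOneSided
import Summits.RiemannHypothesis.RiemannHypothesis.Theorems.AsymptoticCriticalLine.Negative.BandForms

/-!
# RuelleBand / `AsymptoticCriticalLine`: the LASOTA–YORKE ENGINE (a-priori two-norm inequality ⟹ crux)

Route `RiemannHypothesis/RuelleBand`, crux item stmt-RiemannHypothesis-2063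
(`AsymptoticCriticalLine`, "ACL"), line `interior-edge-split`, helper file (`--supports`; registered
periphery stub `asymptoticCriticalLine_of_lasotaYorkeRealisation`). Everything is proved; no
definitions.

WHAT. The route's programme item `MeyerLasotaYorke` (stmt-RiemannHypothesis-11050, informal) promises:
"write a strong anisotropic norm `‖·‖_s` and a weak norm `‖·‖_w` on Meyer's coinvariant space with
the `‖·‖_s`-unit ball relatively `‖·‖_w`-compact, such that the half-density-normalised scaling
semigroup `T_t = π₋(e^t) e^{-t/2}` obeys an A-PRIORI Lasota–Yorke inequality
`‖T_{t₀}ⁿ f‖_s ≤ C_ε e^{n ε t₀} ‖f‖_s + R_{n,ε} ‖f‖_w` for every `ε > 0`; Hennion then gives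
`r_ess(T_{t₀}) ≤ 1` with no spectral input, Meyer's theorem keeps every zero as a joint eigenvalue
`e^{t(ρ - 1/2)}`, and this yields rung #4 directly (one-sided suffices)." This file makes that
inference a THEOREM, so that the pinned norm + the inequality are the ONLY missing inputs for the
crux in Lean:

`asymptoticCriticalLine_of_lasotaYorkeRealisation` — for any complex Hilbert space `H` (the
`‖·‖_s`-completion), any seminorm `w` on `H` (the weak norm) whose restriction to the unit ball is
totally bounded (finite `w`-nets), any family `T : ℝ → (H →L[ℂ] H)` with the semigroup law on
`t ≥ 0`, any `t₀ > 0` with the a-priori inequality above for every `ε > 0`, in which every zero `ρ`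
of `ζ` with `0 < Re ρ < 1` has a one-sided joint eigenvector `T t v = e^{t(ρ - 1/2)} v` (`t ≥ 0`),
the crux `AsymptoticCriticalLine` holds.

PROOF. Fix `ε > 0`; by the one-sided form `acl_iff_rightBand` (reflection `ρ ↦ 1 - ρ`, landed
Negative lane) it suffices that the zeros with `1/2 + ε ≤ Re ρ < 1` are finitely many. Take the
inequality at rate `ε/4` and a power `N` with `e^{N t₀ ε/4} ≥ 2C + 1`; Hennion's decomposition
(`hennion_decomposition`, landed: the Hilbert-space form of Hennion 1993 / Ionescu-Tulcea–Marinescu)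
splits `T_{t₀}^N = T(N t₀) = S + K` with `K` compact and `‖S‖ ≤ 2 C e^{N t₀ ε/4} + 1 ≤ e^{N t₀ ε/2}`.
RESCALE: `T̃ t := e^{-ε t/2} T t` has `T̃(N t₀) = S̃ + K̃` with `‖S̃‖ ≤ 1` (so `σ(S̃)` lies in the
closed unit disc) and `K̃` compact, and every strip zero `ρ` is a one-sided joint eigenvalue of `T̃`
with exponent `ρ - 1/2 - ε/2`; the landed exterior engine
`finite_jointEigenvalues_re_ge_of_spectrum_subset` (analytic Fredholm alternative outside the unit
disc; `RuelleBandBandRealisationOneSided.lean`) leaves finitely many exponents with real part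
`≥ ε/2`, into which the right half-band of level `ε` injects.

HONESTY. As an `∃`-statement over `H` the hypothesis is equivalent to the crux (converse: the
diagonal group on `ℓ²` with `w f = ‖diag(|Re ρ - 1/2|) f‖`, landed as
`lasotaYorkeRealisation_of_asymptoticCriticalLine` in `…LasotaYorkeConverse.lean`) — it types what
the pinned construction must deliver and carries no arithmetic by itself; and the weak-norm term is
not idle (`w = 0` forces `Re ρ = 1/2` for every strip zero, `…SpectralRadiusRH.lean`). Sources:
H. Hennion, Proc. AMS 118 (1993) 627–634; C. T. Ionescu Tulcea – G. Marinescu, Ann. of Math. 52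
(1950); V. Baladi, *Positive transfer operators and decay of correlations* (2000) §2.3; F. Faure –
M. Tsujii, arXiv:1301.5525 §3 (band structure from escape functions); R. Meyer, Duke Math. J. 127
(2005) (the joint eigenvectors).
-/

noncomputable section

-- D-0017: `Summit.<S>.<S>.…` is the designed namespace of a single-problem summit.
set_option linter.dupNamespace false

namespace Summit.RiemannHypothesis.RiemannHypothesis.Theorems

open Complex Filter Topology Set Metric
open Summit.RiemannHypothesis.RiemannHypothesis.Theses.RuelleBand

variable {H : Type} [NormedAddCommGroup H] [InnerProductSpace ℂ H]

/-- Powers of `T t₀` along a semigroup on `t ≥ 0`: `(T t₀)^(n+1) = T ((n+1) t₀)`. (No `T 0 = id`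
is assumed, so the statement starts at exponent `1`.) [folklore] -/
theorem pow_succ_eq_of_semigroup_nonneg (T : ℝ → H →L[ℂ] H) {t₀ : ℝ} (ht₀ : 0 ≤ t₀)
    (hT : ∀ s t : ℝ, 0 ≤ s → 0 ≤ t → T (s + t) = (T s).comp (T t)) (n : ℕ) :
    T t₀ ^ (n + 1) = T (((n : ℝ) + 1) * t₀) := by
  induction n with
  | zero => simp
  | succ k ih =>
    rw [pow_succ, ih, ContinuousLinearMap.mul_def,
      ← hT (((k : ℝ) + 1) * t₀) t₀ (by positivity) ht₀]
    congr 1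
    push_cast
    ring

/-- The rescaled family `t ↦ e^{-a t} T t` turns a one-sided joint eigenvector of exponent `z` into
one of exponent `z - a`. [folklore] -/
theorem rescale_jointEigenvector (T : ℝ → H →L[ℂ] H) (a : ℝ) {z : ℂ} {v : H} {t : ℝ}
    (hv : T t v = Complex.exp (↑t * z) • v) :
    ((((Real.exp (-(a * t)) : ℝ) : ℂ) • T t) v) = Complex.exp (↑t * (z - a)) • v := by
  have h0 : ((((Real.exp (-(a * t)) : ℝ) : ℂ) • T t) v) = ((Real.exp (-(a * t)) : ℝ) : ℂ) • T t v :=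
    rfl
  rw [h0, hv, smul_smul]
  congr 1
  rw [Complex.ofReal_exp, ← Complex.exp_add]
  congr 1
  push_cast
  ring

/-- An exponential eventually dominates any constant: for `κ > 0` and any `M` there is `n ≥ 1` with
`M ≤ e^{n κ}`. [folklore] -/
theorem exists_nat_le_exp_mul {κ : ℝ} (hκ : 0 < κ) (M : ℝ) :
    ∃ n : ℕ, M ≤ Real.exp (((n : ℝ) + 1) * κ) := by
  obtain ⟨n, hn⟩ := exists_nat_ge (M / κ)
  refine ⟨n, ?_⟩
  have h1 : M ≤ (n : ℝ) * κ := (div_le_iff₀ hκ).1 hn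
  have h2 : (n : ℝ) * κ ≤ ((n : ℝ) + 1) * κ := by nlinarith
  have h3 : ((n : ℝ) + 1) * κ ≤ Real.exp (((n : ℝ) + 1) * κ) := by
    linarith [Real.add_one_le_exp (((n : ℝ) + 1) * κ)]
  exact h1.trans (h2.trans h3)

/-- **THE LASOTA–YORKE ENGINE.** A complex Hilbert space `H`, a seminorm `w` on `H` whose
restriction to the unit ball is totally bounded, a family `T : ℝ → (H →L[ℂ] H)` with the semigroup
law on `t ≥ 0`, a time `t₀ > 0` with the a-priori two-norm Lasota–Yorke inequality
`‖(T t₀)ⁿ f‖ ≤ C_ε e^{n ε t₀} ‖f‖ + R_{n,ε} w(f)` for every `ε > 0`, and a one-sided joint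
eigenvector `T t v = e^{t(ρ - 1/2)} v` (`t ≥ 0`) at every zero `ρ` of `ζ` in the open strip,
together imply the crux `AsymptoticCriticalLine`: Hennion's decomposition + rescaling + the
exterior analytic-Fredholm engine + the reflection `ρ ↦ 1 - ρ`. This is the typed landing pad of
the programme item `MeyerLasotaYorke` (stmt-RiemannHypothesis-11050). [folklore] -/
theorem asymptoticCriticalLine_of_lasotaYorkeRealisation :
    ∀ (H : Type) (_ : NormedAddCommGroup H) (_ : InnerProductSpace ℂ H) (_ : CompleteSpace H) (w : Seminorm ℂ H) (T : ℝ → H →L[ℂ] H) (t₀ : ℝ), 0 < t₀ → (∀ s t : ℝ, 0 ≤ s → 0 ≤ t → T (s + t) = (T s).comp (T t)) → (∀ η : ℝ, 0 < η → ∃ F : Finset H, ∀ f : H, ‖f‖ ≤ 1 → ∃ g ∈ F, w (f - g) < η) → (∀ ε : ℝ, 0 < ε → ∃ C : ℝ, ∀ n : ℕ, ∃ R : ℝ, ∀ f : H, ‖(T t₀ ^ n) f‖ ≤ C * Real.exp ((n : ℝ) * ε * t₀) * ‖f‖ + R * w f) → (∀ s : ℂ, riemannZeta s = 0 → 0 <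 s.re → s.re < 1 → ∃ v : H, v ≠ 0 ∧ ∀ t : ℝ, 0 ≤ t → T t v = Complex.exp (↑t * (s - 1 / 2)) • v) → Summit.RiemannHypothesis.RiemannHypothesis.Theses.RuelleBand.AsymptoticCriticalLine := by
  intro H _ _ _ w T t₀ ht₀ hT hw hLY heig
  rw [AsymptoticCriticalLine.Negative.acl_iff_rightBand]
  intro ε hε
  -- (1) the a-priori inequality at rate `ε/4`, constants made nonnegative
  obtain ⟨C, hC⟩ := hLY (ε / 4) (by positivity)
  set C' : ℝ := max C 1 with hC'def
  have hC'1 : 1 ≤ C' := le_max_right _ _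
  have hκ : 0 < ε / 4 * t₀ := by positivity
  -- (2) a power `N = n + 1` with `e^{N t₀ ε/4} ≥ 2C' + 1`
  obtain ⟨n, hn⟩ := exists_nat_le_exp_mul hκ (2 * C' + 1)
  set E : ℝ := Real.exp (((n : ℝ) + 1) * (ε / 4 * t₀)) with hEdef
  have hE1 : 1 ≤ E := by linarith
  obtain ⟨R, hR⟩ := hC (n + 1)
  set R' : ℝ := max R 0 with hR'def
  set r : ℝ := C' * E with hrdef
  have hr0 : 0 ≤ r := by positivity
  have hLY1 : ∀ f : H, ‖(T t₀ ^ (n + 1)) f‖ ≤ r * ‖f‖ + R' * w f := by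
    intro f
    have h := hR f
    have hw0 : 0 ≤ w f := apply_nonneg w f
    have hcast : Real.exp ((((n + 1 : ℕ) : ℝ)) * (ε / 4) * t₀) = E := by
      rw [hEdef]; congr 1; push_cast; ring
    rw [hcast] at h
    calc ‖(T t₀ ^ (n + 1)) f‖ ≤ C * E * ‖f‖ + R * w f := h
      _ ≤ C' * E * ‖f‖ + R' * w f := by
          have hE0 : 0 ≤ E := by rw [hEdef]; exact (Real.exp_pos _).le
          have h1 : C * E * ‖f‖ ≤ C' * E * ‖f‖ :=
            mul_le_mul_of_nonneg_right (mul_le_mul_of_nonneg_right (le_max_left C 1) hE0)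
              (norm_nonneg f)
          have h2 : R * w f ≤ R' * w f := mul_le_mul_of_nonneg_right (le_max_left R 0) hw0
          linarith
  -- (3) Hennion: `T t₀ ^ N = S + K`, `K` compact, `‖S‖ ≤ 2r + 1 ≤ E²`
  obtain ⟨S, K, hSK, hK, hS⟩ := hennion_decomposition H inferInstance inferInstance inferInstance
    (T t₀ ^ (n + 1)) w r R' 1 hr0 (le_max_right R 0) one_pos hLY1 hw
  have hSE : ‖S‖ ≤ E * E := by
    have h1 : 2 * r + 1 ≤ E * E := by
      rw [hrdef]
      nlinarith [mul_nonneg (by linarith : (0 : ℝ) ≤ E) (by linarith : (0 : ℝ) ≤ E - (2 * C' + 1))]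
    exact hS.trans h1
  -- (4) rescale by `a = ε/2`
  set a : ℝ := ε / 2 with hadef
  set τ : ℝ := ((n : ℝ) + 1) * t₀ with hτdef
  have hτ : 0 < τ := by positivity
  have hTτ : T τ = T t₀ ^ (n + 1) := (pow_succ_eq_of_semigroup_nonneg T ht₀.le hT n).symm
  have haτ : Real.exp (a * τ) = E * E := by
    rw [hEdef, ← Real.exp_add, hadef, hτdef]; congr 1; ring
  set c : ℝ := Real.exp (-(a * τ)) with hcdef
  have hc0 : 0 < c := Real.exp_pos _
  have hcE : c * (E * E) = 1 := by
    rw [← haτ, hcdef, ← Real.exp_add]; simp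
  let Ta : ℝ → H →L[ℂ] H := fun t => (((Real.exp (-(a * t)) : ℝ) : ℂ)) • T t
  set Sa : H →L[ℂ] H := ((c : ℝ) : ℂ) • S with hSadef
  have hKa : IsCompactOperator (Ta τ - Sa) := by
    have h1 : Ta τ - Sa = ((c : ℝ) : ℂ) • K := by
      simp only [Ta, hSadef, hTτ, hSK, smul_add, ← hcdef]
      abel
    rw [h1]
    exact hK.smul ((c : ℝ) : ℂ)
  have hSa : spectrum ℂ Sa ⊆ closedBall (0 : ℂ) 1 := by
    intro μ hμ
    rw [mem_closedBall, dist_zero_right]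
    have h1 : ‖μ‖ ≤ ‖Sa‖ * ‖(1 : H →L[ℂ] H)‖ := spectrum.norm_le_norm_mul_of_mem hμ
    have h2 : ‖(1 : H →L[ℂ] H)‖ ≤ 1 := ContinuousLinearMap.norm_id_le
    have h3 : ‖Sa‖ ≤ 1 := by
      rw [hSadef, norm_smul, Complex.norm_real, Real.norm_of_nonneg hc0.le]
      calc c * ‖S‖ ≤ c * (E * E) := by gcongr
        _ = 1 := hcE
    calc ‖μ‖ ≤ ‖Sa‖ * ‖(1 : H →L[ℂ] H)‖ := h1
      _ ≤ 1 * 1 := mul_le_mul h3 h2 (norm_nonneg _) zero_le_one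
      _ = 1 := one_mul 1
  -- (5) the exterior engine for the rescaled family at time `τ`, level `ε/2`
  have hfin := finite_jointEigenvalues_re_ge_of_spectrum_subset Ta hτ hSa hKa (half_pos hε)
  refine (hfin.preimage (f := fun s : ℂ => s - 1 / 2 - (a : ℂ))
    (fun x _ y _ h => sub_left_injective (sub_left_injective h))).subset ?_
  rintro s ⟨hs, hε', h1⟩
  have h0 : 0 < s.re := by linarith
  obtain ⟨v, hv0, hv⟩ := heig s hs h0 h1
  refine ⟨?_, v, hv0, fun t ht => ?_⟩
  · have hre : (s - 1 / 2 - (a : ℂ)).re = s.re - 1 / 2 - a := by simp [Complex.sub_re]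
    show ε / 2 ≤ (s - 1 / 2 - (a : ℂ)).re
    rw [hre]
    linarith
  · exact rescale_jointEigenvector T a (hv t ht)

end Summit.RiemannHypothesis.RiemannHypothesis.Theorems

end
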